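import Mathlib.LinearAlgebra.Matrix.Determinant.Basic
import Mathlib.Data.Sign.Defs
import Mathlib.Algebra.FreeAbelianGroup.Finsupp
import Literature.NumberTheory.Transcendental.KZCalculus
import HarnessLib

/-!
# The toric sub-calculus of the Kontsevich–Zagier moves

Definition item `defn-ToricRelations` (route `KontsevichZagierPeriods/ToricCore`, wanted by
`stmt-KontsevichZagierPeriods-7834` and its siblings): the two subgroups of `KZ.FormalRep` that
every item of that route introduces as `let T := …; let R := …` preludes,

* `KZ.toricSpan` (`T`) — the subgroup generated by the **toric** (signed-binomial) integral
  representations: domain cut out by strict/weak sign conditions on finitely many signed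
  binomials `u xᵃ + w xᵇ` (`u, w ∈ {−1, 0, 1}`, `a, b ∈ ℕⁿ`), integrand a polynomial with rational
  coefficients divided by a product of signed binomials — in logarithmic coordinates: rational
  cones with exponential-rational integrands (Guo–Paycha–Zhang's conical zeta values; Terasoma's
  cones for cyclotomic multiple zeta values);
* `KZ.toricRelations` (`R`) — the subgroup generated by the instances of the KZ moves (1a) domain
  additivity, (1b) integrand additivity and (3) Newton–Leibniz that lie in `toricSpan`, together
  with the **integer monomial changes of variables** `x ↦ (∏ⱼ xⱼ^{A i j})ᵢ`, `A ∈ Mₙ(ℤ)`,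
  `det A ≠ 0`, between toric representations supported in the open positive orthant, with the
  Jacobian factor `|det A| · (∏ᵢ ∏ⱼ xⱼ^{A i j}) / ∏ⱼ xⱼ` (Kontsevich–Zagier 2001 §1.2 moves (1)–(3);
  the cone-subdivision / `GLₙ(ℤ)` dictionary of Guo–Paycha–Zhang 2014).

The bodies of `toricSpan` and `toricRelations` are, token for token, the two `let` preludes of the
route items (with `T ↦ toricSpan`), so that an item `let T := …; let R := …; P T R` restates as
`P toricSpan toricRelations` by `rfl`. Pure definitions over `KZCalculus.lean`; nothing asserted.

## API (proved)

* `IsToric r` — the toric predicate on a single representation, and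
  `mem_toricGenerators_iff` / `of_mem_toricSpan_iff : KZ.of r ∈ toricSpan ↔ IsToric r`
  (a generator of a free abelian group lies in the subgroup generated by a set of generators iff
  it is one of them: evaluate Mathlib's coefficient functional `FreeAbelianGroup.coeff` of that
  generator);
* `of_mem_toricSpan`, `monomialRel_subset_toricRelations`, `inter_toricSpan_subset_toricRelations`,
  `toricRelations_le` (the obvious inclusions), `sub_mem_toricRelations_of_monomial` (how a
  monomial move is used).

## Deliberately NOT here

* `toricRelations ≤ KZ.relations` (the route's item `ToricSound`: an integer monomial map with
  `det A ≠ 0` on a domain in the open positive orthant is a legitimate move (2) —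
  `ℚ`-semialgebraic, differentiable, injective, `|det DΦ| = |det A| ∏ᵢ∏ⱼ xⱼ^{A i j} / ∏ⱼ xⱼ`), the
  membership of the multiple-zeta representations (`mzvRep_mem_toricSpan`), cube restriction and
  product lemmas: prover items / follow-ups of the route, not definitions.

## References

* M. Kontsevich, D. Zagier, *Periods* (2001), §1.2 (the moves). [`KontsevichZagier2001`]
* L. Guo, S. Paycha, B. Zhang, *Conical zeta values and their double subdivision relations*,
  Adv. Math. 252 (2014) 343–381 (cones, subdivisions, `GLₙ(ℤ)`). [`GuoPaychaZhang2014`]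
* T. Terasoma, *Rational convex cones and cyclotomic multiple zeta values*, arXiv:math/0410306.
-/

noncomputable section

open MeasureTheory MvPolynomial Set

namespace Literature.NumberTheory.Transcendental

namespace KZ

/-! ### Toric representations and the toric span -/

/-- A **signed binomial** on `ℝⁿ`: `x ↦ u · ∏ᵢ xᵢ^{aᵢ} + w · ∏ᵢ xᵢ^{bᵢ}` with signs
`u, w ∈ {−1, 0, 1}` and exponents `a, b ∈ ℕⁿ` (so monomials `±xᵃ`, differences `xᵃ − xᵇ`, and
`1 − xᵃ` are all signed binomials). [cite: GuoPaychaZhang2014, §2 (cones cut out by binomial inequalities, log coordinates)] -/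
def IsSignedBinomial {n : ℕ} (f : (Fin n → ℝ) → ℝ) : Prop :=
  ∃ (u w : SignType) (a b : Fin n → ℕ), f = fun x => (u : ℝ) * (∏ i, x i ^ a i) + (w : ℝ) * (∏ i, x i ^ b i)

/-- An integral representation is **toric** if its domain is cut out by finitely many strict and
weak signed-binomial inequalities and its integrand is, on the domain, a rational-coefficient
polynomial divided by a product of signed binomials (the summands of Guo–Paycha–Zhang's conical
zeta values / Terasoma's cone integrals, written multiplicatively). [cite: GuoPaychaZhang2014, §2] -/
def IsToric {n : ℕ} (r : IntegralRep n) : Prop :=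
  ∃ (N M K : ℕ) (g : Fin N → (Fin n → ℝ) → ℝ) (h : Fin M → (Fin n → ℝ) → ℝ)
    (d : Fin K → (Fin n → ℝ) → ℝ) (P : MvPolynomial (Fin n) ℚ),
    (∀ f ∈ Set.range g ∪ Set.range h ∪ Set.range d, IsSignedBinomial f) ∧
    r.domain = {x | (∀ k, 0 < g k x) ∧ ∀ k, 0 ≤ h k x} ∧
    Set.EqOn r.integrand (fun x => MvPolynomial.aeval x P / ∏ k, d k x) r.domain

/-- **The toric span** `T ⊆ FormalRep`: the subgroup generated by the classes `[r]` of the toric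
integral representations. The body is verbatim the `let T := …` prelude of the items of route
`ToricCore` (e.g. `stmt-KontsevichZagierPeriods-7834`). [cite: KontsevichZagier2001, §1.2] -/
def toricSpan : AddSubgroup FormalRep :=
  AddSubgroup.closure {c | ∃ (n N M K : ℕ) (r : IntegralRep n) (g : Fin N → (Fin n → ℝ) → ℝ)
    (h : Fin M → (Fin n → ℝ) → ℝ) (d : Fin K → (Fin n → ℝ) → ℝ) (P : MvPolynomial (Fin n) ℚ),
    (∀ f ∈ Set.range g ∪ Set.range h ∪ Set.range d, ∃ (u w : SignType) (a b : Fin n → ℕ),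
      f = fun x => (u : ℝ) * (∏ i, x i ^ a i) + (w : ℝ) * (∏ i, x i ^ b i)) ∧
    r.domain = {x | (∀ k, 0 < g k x) ∧ ∀ k, 0 ≤ h k x} ∧
    Set.EqOn r.integrand (fun x => MvPolynomial.aeval x P / ∏ k, d k x) r.domain ∧ c = of r}

/-- **The monomial moves**: `[r] − [r']` for toric `r`, `r'` in the same dimension related by an
integer monomial change of variables `Φ_A x = (∏ⱼ xⱼ^{A i j})ᵢ`, `A ∈ Mₙ(ℤ)`, `det A ≠ 0`, on a
domain inside the open positive orthant, with the Jacobian factor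
`|det DΦ_A(x)| = |det A| · (∏ᵢ ∏ⱼ xⱼ^{A i j}) / ∏ⱼ xⱼ` (Kontsevich–Zagier's move (2) for these
maps; the `GLₙ(ℤ)`/subdivision operations on cones of Guo–Paycha–Zhang in multiplicative
coordinates). Verbatim the second generator set of the items' `let R := …`. [cite: KontsevichZagier2001, §1.2 rule (2)] -/
def monomialRel : Set FormalRep :=
  {c | ∃ (n : ℕ) (r r' : IntegralRep n) (A : Matrix (Fin n) (Fin n) ℤ), of r ∈ toricSpan ∧
    of r' ∈ toricSpan ∧ A.det ≠ 0 ∧ (∀ x ∈ r.domain, ∀ i, 0 < x i) ∧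
    r'.domain = (fun x i => ∏ j, x j ^ A i j) '' r.domain ∧
    (∀ x ∈ r.domain, r.integrand x =
      r'.integrand (fun i => ∏ j, x j ^ A i j) * (|(A.det : ℝ)| * (∏ i, ∏ j, x j ^ A i j) / ∏ j, x j)) ∧
    c = of r - of r'}

/-- **The toric relations** `R ⊆ FormalRep`: the subgroup generated by the instances of the moves
(1a), (1b), (3) of the KZ calculus (`domainAddRel`, `integrandAddRel`, `newtonLeibnizRel`) lying
in the toric span, and by the monomial moves. The body is verbatim the `let R := …` prelude of the
items of route `ToricCore` with `T ↦ toricSpan` (its second generator set is `monomialRel`,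
inlined). [cite: KontsevichZagier2001, §1.2] -/
def toricRelations : AddSubgroup FormalRep :=
  AddSubgroup.closure (((domainAddRel ∪ integrandAddRel ∪ newtonLeibnizRel) ∩
      (toricSpan : Set FormalRep)) ∪
    {c | ∃ (n : ℕ) (r r' : IntegralRep n) (A : Matrix (Fin n) (Fin n) ℤ), of r ∈ toricSpan ∧
      of r' ∈ toricSpan ∧ A.det ≠ 0 ∧ (∀ x ∈ r.domain, ∀ i, 0 < x i) ∧
      r'.domain = (fun x i => ∏ j, x j ^ A i j) '' r.domain ∧
      (∀ x ∈ r.domain, r.integrand x =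
        r'.integrand (fun i => ∏ j, x j ^ A i j) * (|(A.det : ℝ)| * (∏ i, ∏ j, x j ^ A i j) / ∏ j, x j)) ∧
      c = of r - of r'})

/-! ### API -/

/-- The generating set of `toricSpan` is the set of classes of toric representations. [folklore] -/
theorem mem_toricGenerators_iff {c : FormalRep} :
    c ∈ {c | ∃ (n N M K : ℕ) (r : IntegralRep n) (g : Fin N → (Fin n → ℝ) → ℝ)
      (h : Fin M → (Fin n → ℝ) → ℝ) (d : Fin K → (Fin n → ℝ) → ℝ) (P : MvPolynomial (Fin n) ℚ),
      (∀ f ∈ Set.range g ∪ Set.range h ∪ Set.range d, ∃ (u w : SignType) (a b : Fin n → ℕ),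
        f = fun x => (u : ℝ) * (∏ i, x i ^ a i) + (w : ℝ) * (∏ i, x i ^ b i)) ∧
      r.domain = {x | (∀ k, 0 < g k x) ∧ ∀ k, 0 ≤ h k x} ∧
      Set.EqOn r.integrand (fun x => MvPolynomial.aeval x P / ∏ k, d k x) r.domain ∧ c = of r} ↔
      ∃ (n : ℕ) (r : IntegralRep n), IsToric r ∧ c = of r := by
  constructor
  · rintro ⟨n, N, M, K, r, g, h, d, P, hb, hdom, hint, rfl⟩
    exact ⟨n, r, ⟨N, M, K, g, h, d, P, hb, hdom, hint⟩, rfl⟩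
  · rintro ⟨n, r, ⟨N, M, K, g, h, d, P, hb, hdom, hint⟩, rfl⟩
    exact ⟨n, N, M, K, r, g, h, d, P, hb, hdom, hint, rfl⟩

/-- `toricSpan` is the closure of the classes of toric representations. [folklore] -/
theorem toricSpan_eq_closure :
    toricSpan = AddSubgroup.closure {c | ∃ (n : ℕ) (r : IntegralRep n), IsToric r ∧ c = of r} := by
  unfold toricSpan
  congr 1
  ext c
  exact mem_toricGenerators_iff

/-- The class of a toric representation lies in the toric span. [folklore] -/
theorem of_mem_toricSpan {n : ℕ} {r : IntegralRep n} (h : IsToric r) : of r ∈ toricSpan := by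
  rw [toricSpan_eq_closure]
  exact AddSubgroup.subset_closure ⟨n, r, h, rfl⟩

/-- **A generator lies in the toric span iff it is toric**: `[r] ∈ T ↔ r` is toric (evaluate the
coefficient functional of `[r]`, which kills every other generator and hence the closure). [folklore] -/
theorem of_mem_toricSpan_iff {n : ℕ} {r : IntegralRep n} : of r ∈ toricSpan ↔ IsToric r := by
  classical
  refine ⟨fun hmem => ?_, of_mem_toricSpan⟩
  by_contra hnot
  -- Mathlib's coefficient functional of the generator `⟨n, r⟩` vanishes on all the (other)
  -- generators, hence on the closure
  set φ : FormalRep →+ ℤ := FreeAbelianGroup.coeff (⟨n, r⟩ : Σ n, IntegralRep n) with hφ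
  have hgen : ∀ c ∈ {c | ∃ (m : ℕ) (r' : IntegralRep m), IsToric r' ∧ c = of r'}, φ c = 0 := by
    rintro c ⟨m, r', hr', rfl⟩
    have hne : (⟨m, r'⟩ : Σ n, IntegralRep n) ≠ ⟨n, r⟩ := by
      rintro heq
      cases heq
      exact hnot hr'
    simp [hφ, FreeAbelianGroup.coeff, of, hne]
  have hker : AddSubgroup.closure {c | ∃ (m : ℕ) (r' : IntegralRep m), IsToric r' ∧ c = of r'} ≤
      φ.ker := (AddSubgroup.closure_le _).2 fun c hc => by simpa using hgen c hc
  rw [toricSpan_eq_closure] at hmem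
  have h0 : φ (of r) = 0 := by simpa using hker hmem
  have h1 : φ (of r) = 1 := by
    simp [hφ, FreeAbelianGroup.coeff, of]
  rw [h0] at h1
  exact zero_ne_one h1

/-- The generating set of `toricRelations`, named: toric instances of moves (1a), (1b), (3), and
the monomial moves. [folklore] -/
theorem toricRelations_eq_closure :
    toricRelations = AddSubgroup.closure
      (((domainAddRel ∪ integrandAddRel ∪ newtonLeibnizRel) ∩ (toricSpan : Set FormalRep)) ∪
        monomialRel) := rfl

/-- A monomial move is a toric relation. [cite: KontsevichZagier2001, §1.2 rule (2)] -/
theorem monomialRel_subset_toricRelations : monomialRel ⊆ toricRelations := fun _ hc =>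
  AddSubgroup.subset_closure (Or.inr hc)

/-- An instance of the moves (1a), (1b), (3) lying in the toric span is a toric relation. [cite: KontsevichZagier2001, §1.2] -/
theorem inter_toricSpan_subset_toricRelations :
    (domainAddRel ∪ integrandAddRel ∪ newtonLeibnizRel) ∩ (toricSpan : Set FormalRep) ⊆
      toricRelations := fun _ hc =>
  AddSubgroup.subset_closure (Or.inl hc)

/-- How a monomial move is used: for toric `r`, `r'` related by `Φ_A`, `det A ≠ 0`, on a domain in
the open positive orthant, `[r] − [r'] ∈ R`. [cite: KontsevichZagier2001, §1.2 rule (2)] -/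
theorem sub_mem_toricRelations_of_monomial {n : ℕ} {r r' : IntegralRep n}
    (hr : of r ∈ toricSpan) (hr' : of r' ∈ toricSpan) (A : Matrix (Fin n) (Fin n) ℤ)
    (hA : A.det ≠ 0) (hpos : ∀ x ∈ r.domain, ∀ i, 0 < x i)
    (hdom : r'.domain = (fun x i => ∏ j, x j ^ A i j) '' r.domain)
    (hint : ∀ x ∈ r.domain, r.integrand x =
      r'.integrand (fun i => ∏ j, x j ^ A i j) * (|(A.det : ℝ)| * (∏ i, ∏ j, x j ^ A i j) / ∏ j, x j)) :
    of r - of r' ∈ toricRelations :=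
  monomialRel_subset_toricRelations ⟨n, r, r', A, hr, hr', hA, hpos, hdom, hint, rfl⟩

/-- `toricRelations` is generated inside `KZ`'s formal group by moves each of which is either a
KZ move of type (1a), (1b), (3) or a monomial move; hence it is contained in any subgroup
containing those. [folklore] -/
theorem toricRelations_le {S : AddSubgroup FormalRep}
    (h₁ : (domainAddRel ∪ integrandAddRel ∪ newtonLeibnizRel) ∩ (toricSpan : Set FormalRep) ⊆ S)
    (h₂ : monomialRel ⊆ S) : toricRelations ≤ S :=
  (AddSubgroup.closure_le _).2 (Set.union_subset h₁ h₂)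

end KZ

end Literature.NumberTheory.Transcendental
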